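import Summits.HodgeConjecture.HodgeConjecture.Theorems.F0P3cStCharTSFilteredNewtonHaar   -- ★ (C1b): `map_restrict_eq_restrict_of_newton`; brings (C1a) `image_coe_eq_of_newton`, `injOn_of_newton`
import Literature.MeasureTheory.Group.HaarLocalChartLeft                                   -- ★ `eq_smul_restrict_of_locallyInvariant` (Helgason's averaging lemma, left Haar)
import HarnessLib

/-!
# F0 · P3c · line LH6 «StCharTS» — WIF antecedent, ELLIPTIC half via the ★ Cayley window: brick (C3) «HAAR MEASURE IN A NEWTON CHART» —
# a chart in which left translations are «the identity up to one level» carries additive Haar measure to a constant multiple of Haar measure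

Cell `pub/hodgecm-mathlib`, crux H413 = `stmt-HodgeConjecture-24833` (lane `--supports … --as helper`), route HCCMUnconditional; seat LH5-p02 (g6)
(offer «JAC-ELL via the ★ CAYLEY WINDOW», bus F0∕P3b 2026-09-02T14:29Z).  THEOREMS ONLY (no definition ∕ instance ∕ notation ∕ named fact ∕ `sorry`);
Mathlib + ★ (C1a)∕(C1b) `F0P3cStCharTSFilteredNewton{,Haar}` + ★ `Literature.MeasureTheory.Group.HaarLocalChartLeft`.

SETTING (abstract chart; the Cayley window of `GL_m` ∕ `U(J)` over a local field is the instance, with (N) supplied by ★ (C2)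
`Literature/NumberTheory/Weil1982/CayleyProductSandwich`).  `V` a filtered abelian group as in (C1) (`Λ` antitone, open, `Λ k` compact,
neighbourhood basis of `0`; `V` Hausdorff, second countable, Borel) with a left-invariant Borel measure `μ` finite on compacts; `G` a second
countable locally compact group with a Haar measure `ν`; a CHART `c : V → G`, continuous and injective on the base box `Λ k`, whose image
`K := c '' Λ k` is OPEN, such that
* (T) every left translation by a chart element is a Newton map in the chart: for `W ∈ Λ k` there is `ψ : V → V`, continuous on `Λ k`, with
  `ψ 0 ∈ Λ k`, the filtered Newton hypothesis `(N)` at depth `k`, and `c (ψ X) = c W · c X` on `Λ k`;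
* (I) the image is symmetric: for `W ∈ Λ k` there is `W′ ∈ Λ k` with `c W′ = (c W)⁻¹`.

THE RESULTS (all PROVED).
* `inv_mem_image`, `image_inv_eq` (`K⁻¹ = K`), `mul_mem_image` (`K·K ⊆ K`), `inv_mem_image_of_preimage_subset` — the window is a compact open «subgroup carrier».
* `map_restrict_apply_eq`, `map_restrict_preimage_mul_eq` — the chart measure `ν′ := (μ.restrict (Λ k)).map c` is carried by `K` and LOCALLY
  LEFT-INVARIANT on the window `K` (for `g ∈ G`, measurable `B ⊆ K` with `g⁻¹B ⊆ K`: `ν′(g⁻¹B) = ν′(B)`) — by (T), (I) and ★ (C1b) applied to `ψ`.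
* **`map_restrict_eq_smul_haar`** — `ν′ = κ • ν.restrict K` with **`κ = μ (Λ k) / ν K`** (★ `HaarLocalChartLeft.eq_smul_restrict_of_locallyInvariant`, the
  constant read off at `B = K`); in words: ADDITIVE HAAR MEASURE ON THE BOX, PUSHED THROUGH THE CHART, IS HAAR MEASURE ON THE WINDOW.
* `measure_image_eq` — for `A ⊆ Λ k` with Borel image: `μ A = (μ (Λ k) / ν K) · ν (c '' A)`.

HONEST LABEL: HC_CM is proved only modulo the 7 printed citations (2 remaining named inputs: hLiu418 = `stmt-HodgeConjecture-24832`, h413 =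
`stmt-HodgeConjecture-24833`) until rung 0 closes; this file closes no organ (count-neutral bank for the elliptic half of the WIF antecedent of RUNG0).

## References
* [Helgason2000] S. Helgason, *Groups and Geometric Analysis* (2000), Ch. I §1 Thm. 1.14 (13) p. 96 (Haar measure in a chart; the averaging device). Context locator.
* [Serre1992LALG] J.-P. Serre, *Lie Algebras and Lie Groups*, LNM 1500 (1992), Part II Ch. IV §8–§9 (standard groups). Context locator.
* [HarishChandra1970] Harish-Chandra (notes by G. van Dijk), *Harmonic Analysis on Reductive p-adic Groups*, LNM 162 (1970), Lemma 22 (the consumer).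
-/

set_option autoImplicit false
set_option linter.dupNamespace false

open Set Filter MeasureTheory MeasureTheory.Measure TopologicalSpace
open Summit.HodgeConjecture.HodgeConjecture.Cruxes.H413.F0P3cStCharTSFilteredNewton
open Summit.HodgeConjecture.HodgeConjecture.Cruxes.H413.F0P3cStCharTSFilteredNewtonHaar
open scoped Pointwise Topology ENNReal

namespace Summit.HodgeConjecture.HodgeConjecture.Cruxes.H413.F0P3cStCharTSNewtonChartHaar

/-! ## §1 The window is a compact open subgroup carrier -/

section Window

variable {V G : Type*} [AddCommGroup V] [Group G] (Λ : ℕ → AddSubgroup V) {k : ℕ} (c : V → G)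

/-- Under (I) the window is closed under inverses. [cite: Serre1992LALG, Part II Ch. IV §8] -/
theorem inv_mem_image (hI : ∀ W ∈ Λ k, ∃ W' ∈ Λ k, c W' = (c W)⁻¹) {g : G} (hg : g ∈ c '' (Λ k : Set V)) :
    g⁻¹ ∈ c '' (Λ k : Set V) := by
  obtain ⟨W, hW, rfl⟩ := hg
  obtain ⟨W', hW', h⟩ := hI W hW
  exact ⟨W', hW', h⟩

/-- Under (I): `g⁻¹ ∈ K ↔ g ∈ K`, i.e. `K⁻¹ = K`. [cite: Serre1992LALG, Part II Ch. IV §8] -/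
theorem image_inv_eq (hI : ∀ W ∈ Λ k, ∃ W' ∈ Λ k, c W' = (c W)⁻¹) : (c '' (Λ k : Set V))⁻¹ = c '' (Λ k : Set V) := by
  ext g
  rw [Set.mem_inv]
  constructor
  · intro h
    have := inv_mem_image Λ c hI h
    rwa [inv_inv] at this
  · exact inv_mem_image Λ c hI

variable [TopologicalSpace V] [IsTopologicalAddGroup V] [T2Space V]

/-- Under (T) the window is closed under products: `c W · c X = c (ψ X) ∈ c '' Λ k`. [cite: Serre1992LALG, Part II Ch. IV §8] -/
theorem mul_mem_image (hanti : Antitone Λ) (hopen : ∀ j, IsOpen (Λ j : Set V))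
    (hcomp : IsCompact (Λ k : Set V)) (hbasis : ∀ U ∈ 𝓝 (0 : V), ∃ j, (Λ j : Set V) ⊆ U)
    (hT : ∀ W ∈ Λ k, ∃ ψ : V → V, ContinuousOn ψ (Λ k : Set V) ∧ ψ 0 ∈ Λ k ∧
      (∀ j, k ≤ j → ∀ x ∈ Λ k, ∀ y ∈ Λ j, ψ (x + y) - ψ x - y ∈ Λ (j + 1)) ∧ ∀ X ∈ Λ k, c (ψ X) = c W * c X)
    {W X : V} (hW : W ∈ Λ k) (hX : X ∈ Λ k) : c W * c X ∈ c '' (Λ k : Set V) := by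
  obtain ⟨ψ, hψc, hψ0, hN, hmul⟩ := hT W hW
  have himg := image_coe_eq_of_newton Λ ψ hanti hopen hcomp hbasis hψc hN hψ0
  have hψX : ψ X ∈ (Λ k : Set V) := himg ▸ mem_image_of_mem ψ hX
  exact ⟨ψ X, hψX, hmul X hX⟩

/-- If `B ⊆ K` is non-empty and `g⁻¹B ⊆ K` then `g⁻¹ ∈ K` (so `g`, `g⁻¹` are chart elements). [cite: Serre1992LALG, Part II Ch. IV §8] -/
theorem inv_mem_image_of_preimage_subset (hanti : Antitone Λ) (hopen : ∀ j, IsOpen (Λ j : Set V))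
    (hcomp : IsCompact (Λ k : Set V)) (hbasis : ∀ U ∈ 𝓝 (0 : V), ∃ j, (Λ j : Set V) ⊆ U)
    (hT : ∀ W ∈ Λ k, ∃ ψ : V → V, ContinuousOn ψ (Λ k : Set V) ∧ ψ 0 ∈ Λ k ∧
      (∀ j, k ≤ j → ∀ x ∈ Λ k, ∀ y ∈ Λ j, ψ (x + y) - ψ x - y ∈ Λ (j + 1)) ∧ ∀ X ∈ Λ k, c (ψ X) = c W * c X)
    (hI : ∀ W ∈ Λ k, ∃ W' ∈ Λ k, c W' = (c W)⁻¹)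
    {g : G} {B : Set G} (hB : B ⊆ c '' (Λ k : Set V)) (hne : B.Nonempty)
    (hgB : (fun x => g * x) ⁻¹' B ⊆ c '' (Λ k : Set V)) : g⁻¹ ∈ c '' (Λ k : Set V) := by
  obtain ⟨b, hb⟩ := hne
  have h1 : g⁻¹ * b ∈ c '' (Λ k : Set V) := hgB (show g * (g⁻¹ * b) ∈ B by simpa using hb)
  have h2 : b⁻¹ ∈ c '' (Λ k : Set V) := inv_mem_image Λ c hI (hB hb)
  obtain ⟨W₁, hW₁, h₁⟩ := h1
  obtain ⟨W₂, hW₂, h₂⟩ := h2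
  have := mul_mem_image Λ c hanti hopen hcomp hbasis hT hW₁ hW₂
  rwa [h₁, h₂, mul_inv_cancel_right] at this

end Window

/-! ## §2 The chart measure is carried by the window and locally left-invariant on it -/

section Measurability

variable {V G : Type*} [TopologicalSpace V] [MeasurableSpace V] [OpensMeasurableSpace V]
  [TopologicalSpace G] [MeasurableSpace G] [BorelSpace G] (c : V → G)

/-- Preimages under a function continuous on a measurable set are measurable inside it. [cite: Helgason2000, Ch. I §1 Thm. 1.14] -/
theorem measurableSet_inter_preimage_of_continuousOn {S : Set V} (hS : MeasurableSet S) (hc : ContinuousOn c S) {B : Set G}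
    (hB : MeasurableSet B) : MeasurableSet (S ∩ c ⁻¹' B) := by
  have h : Continuous (S.restrict c) := continuousOn_iff_continuous_restrict.mp hc
  have hm : MeasurableSet ((S.restrict c) ⁻¹' B) := h.measurable hB
  have : S ∩ c ⁻¹' B = Subtype.val '' ((S.restrict c) ⁻¹' B) := by
    ext x; constructor
    · rintro ⟨hx, hxB⟩; exact ⟨⟨x, hx⟩, hxB, rfl⟩
    · rintro ⟨⟨y, hy⟩, hyB, rfl⟩; exact ⟨hy, hyB⟩
  rw [this]
  exact MeasurableSet.subtype_image hS hm

end Measurability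

section Chart

variable {V G : Type*} [AddCommGroup V] [TopologicalSpace V] [MeasurableSpace V] [BorelSpace V]
  [TopologicalSpace G] [MeasurableSpace G] [BorelSpace G]
  (Λ : ℕ → AddSubgroup V) {k : ℕ} (c : V → G) (μ : Measure V)

/-- The chart measure of a Borel set: `ν′ B = μ (Λ k ∩ c⁻¹ B)`. [cite: Helgason2000, Ch. I §1 Thm. 1.14] -/
theorem map_restrict_apply_eq (hopen : ∀ j, IsOpen (Λ j : Set V)) (hc : ContinuousOn c (Λ k : Set V))
    {B : Set G} (hB : MeasurableSet B) :
    ((μ.restrict (Λ k : Set V)).map c) B = μ ((Λ k : Set V) ∩ c ⁻¹' B) := by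
  have hΛk : MeasurableSet (Λ k : Set V) := (hopen k).measurableSet
  rw [map_apply_of_aemeasurable (hc.aemeasurable hΛk) hB, restrict_apply' hΛk, inter_comm]

/-- The chart measure is carried by the window: `ν′ Kᶜ = 0`. [cite: Helgason2000, Ch. I §1 Thm. 1.14] -/
theorem map_restrict_compl_image_eq_zero [T2Space G] (hopen : ∀ j, IsOpen (Λ j : Set V))
    (hcomp : IsCompact (Λ k : Set V)) (hc : ContinuousOn c (Λ k : Set V)) :
    ((μ.restrict (Λ k : Set V)).map c) (c '' (Λ k : Set V))ᶜ = 0 := by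
  have hK : MeasurableSet (c '' (Λ k : Set V)) := (hcomp.image_of_continuousOn hc).isClosed.measurableSet
  rw [map_restrict_apply_eq Λ c μ hopen hc hK.compl]
  have : (Λ k : Set V) ∩ c ⁻¹' (c '' (Λ k : Set V))ᶜ = ∅ := by
    ext x
    simp only [mem_inter_iff, mem_preimage, mem_compl_iff, mem_image, mem_empty_iff_false, iff_false, not_and, not_not]
    exact fun hx => ⟨x, hx, rfl⟩
  rw [this, measure_empty]

variable [IsTopologicalAddGroup V] [T2Space V] [SecondCountableTopology V] [IsFiniteMeasureOnCompacts μ] [μ.IsAddLeftInvariant]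
  [Group G] [IsTopologicalGroup G]

/-- **LOCAL LEFT-INVARIANCE ON THE WINDOW**: for `g ∈ G` and measurable `B ⊆ K` with `g⁻¹B ⊆ K`, `ν′(g⁻¹B) = ν′(B)` — the left translation by
`g = c W` reads `ψ` in the chart, and `ψ` preserves `μ|_{Λ k}` (★ (C1b)). [cite: Helgason2000, Ch. I §1 Thm. 1.14 (13) p. 96] -/
theorem map_restrict_preimage_mul_eq [T2Space G] (hanti : Antitone Λ) (hopen : ∀ j, IsOpen (Λ j : Set V))
    (hcomp : IsCompact (Λ k : Set V)) (hbasis : ∀ U ∈ 𝓝 (0 : V), ∃ j, (Λ j : Set V) ⊆ U)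
    (hc : ContinuousOn c (Λ k : Set V))
    (hT : ∀ W ∈ Λ k, ∃ ψ : V → V, ContinuousOn ψ (Λ k : Set V) ∧ ψ 0 ∈ Λ k ∧
      (∀ j, k ≤ j → ∀ x ∈ Λ k, ∀ y ∈ Λ j, ψ (x + y) - ψ x - y ∈ Λ (j + 1)) ∧ ∀ X ∈ Λ k, c (ψ X) = c W * c X)
    (hI : ∀ W ∈ Λ k, ∃ W' ∈ Λ k, c W' = (c W)⁻¹)
    (g : G) (B : Set G) (hBm : MeasurableSet B) (hB : B ⊆ c '' (Λ k : Set V))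
    (hgB : (fun x => g * x) ⁻¹' B ⊆ c '' (Λ k : Set V)) :
    ((μ.restrict (Λ k : Set V)).map c) ((fun x => g * x) ⁻¹' B) = ((μ.restrict (Λ k : Set V)).map c) B := by
  rcases B.eq_empty_or_nonempty with rfl | hne
  · simp
  -- `g = c W` for a chart element `W`
  have hginv : g⁻¹ ∈ c '' (Λ k : Set V) := inv_mem_image_of_preimage_subset Λ c hanti hopen hcomp hbasis hT hI hB hne hgB
  have hg : g ∈ c '' (Λ k : Set V) := by
    have := inv_mem_image Λ c hI hginv
    rwa [inv_inv] at this
  obtain ⟨W, hW, rfl⟩ := hg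
  obtain ⟨ψ, hψc, hψ0, hN, hmul⟩ := hT W hW
  have himg := image_coe_eq_of_newton Λ ψ hanti hopen hcomp hbasis hψc hN hψ0
  have hΛk : MeasurableSet (Λ k : Set V) := (hopen k).measurableSet
  -- the chart set `A = Λ k ∩ c⁻¹ B`
  have hA : MeasurableSet ((Λ k : Set V) ∩ c ⁻¹' B) := measurableSet_inter_preimage_of_continuousOn c hΛk hc hBm
  rw [map_restrict_apply_eq Λ c μ hopen hc (hBm.preimage (measurable_const_mul (c W))),
    map_restrict_apply_eq Λ c μ hopen hc hBm]
  -- in the chart, `x ↦ c W * c x` is `ψ`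
  have hset : (Λ k : Set V) ∩ c ⁻¹' ((fun x => c W * x) ⁻¹' B) = (Λ k : Set V) ∩ ψ ⁻¹' ((Λ k : Set V) ∩ c ⁻¹' B) := by
    ext X
    simp only [mem_inter_iff, mem_preimage]
    constructor
    · rintro ⟨hX, hXB⟩
      have hψX : ψ X ∈ (Λ k : Set V) := himg ▸ mem_image_of_mem ψ hX
      exact ⟨hX, hψX, by rwa [hmul X hX]⟩
    · rintro ⟨hX, -, hψB⟩
      exact ⟨hX, by rwa [hmul X hX] at hψB⟩
  rw [hset]
  have key := map_restrict_eq_restrict_of_newton Λ ψ μ hanti hopen hcomp hbasis hψc hN hψ0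
  have h1 : μ ((Λ k : Set V) ∩ ψ ⁻¹' ((Λ k : Set V) ∩ c ⁻¹' B))
      = ((μ.restrict (Λ k : Set V)).map ψ) ((Λ k : Set V) ∩ c ⁻¹' B) := by
    rw [map_apply_of_aemeasurable (hψc.aemeasurable hΛk) hA, restrict_apply' hΛk, inter_comm]
  rw [h1, key, restrict_apply' hΛk, inter_eq_left.2 inter_subset_left]

end Chart

/-! ## §3 Haar measure in the chart -/

section Haar

variable {V G : Type*} [AddCommGroup V] [TopologicalSpace V] [IsTopologicalAddGroup V] [T2Space V]
  [SecondCountableTopology V] [MeasurableSpace V] [BorelSpace V]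
  [Group G] [TopologicalSpace G] [IsTopologicalGroup G] [LocallyCompactSpace G] [SecondCountableTopology G] [T2Space G]
  [MeasurableSpace G] [BorelSpace G]
  (Λ : ℕ → AddSubgroup V) {k : ℕ} (c : V → G)
  (μ : Measure V) [IsFiniteMeasureOnCompacts μ] [μ.IsAddLeftInvariant]
  (ν : Measure G) [ν.IsHaarMeasure]

/-- **HAAR MEASURE IN A NEWTON CHART.**  Under (T), (I), with `c` continuous on the compact base box and `K = c '' Λ k` open:
`(μ.restrict (Λ k)).map c = (μ (Λ k) / ν K) • ν.restrict K`. [cite: Helgason2000, Ch. I §1 Thm. 1.14 (13) p. 96] -/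
theorem map_restrict_eq_smul_haar (hanti : Antitone Λ) (hopen : ∀ j, IsOpen (Λ j : Set V))
    (hcomp : IsCompact (Λ k : Set V)) (hbasis : ∀ U ∈ 𝓝 (0 : V), ∃ j, (Λ j : Set V) ⊆ U)
    (hc : ContinuousOn c (Λ k : Set V)) (hKo : IsOpen (c '' (Λ k : Set V)))
    (hT : ∀ W ∈ Λ k, ∃ ψ : V → V, ContinuousOn ψ (Λ k : Set V) ∧ ψ 0 ∈ Λ k ∧
      (∀ j, k ≤ j → ∀ x ∈ Λ k, ∀ y ∈ Λ j, ψ (x + y) - ψ x - y ∈ Λ (j + 1)) ∧ ∀ X ∈ Λ k, c (ψ X) = c W * c X)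
    (hI : ∀ W ∈ Λ k, ∃ W' ∈ Λ k, c W' = (c W)⁻¹) :
    (μ.restrict (Λ k : Set V)).map c = (μ (Λ k : Set V) / ν (c '' (Λ k : Set V))) • ν.restrict (c '' (Λ k : Set V)) := by
  set K : Set G := c '' (Λ k : Set V) with hKdef
  have hKc : IsCompact K := hcomp.image_of_continuousOn hc
  have hKm : MeasurableSet K := hKc.isClosed.measurableSet
  have hKne : K.Nonempty := ⟨c 0, 0, zero_mem _, rfl⟩
  haveI : IsFiniteMeasure (μ.restrict (Λ k : Set V)) := isFiniteMeasure_restrict.2 hcomp.measure_lt_top.ne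
  haveI : IsFiniteMeasure ((μ.restrict (Λ k : Set V)).map c) := isFiniteMeasure_map _ _
  have hKinv : K⁻¹ = K := image_inv_eq Λ c hI
  have hK0 : ν K⁻¹ ≠ 0 := by rw [hKinv]; exact (hKo.measure_pos ν hKne).ne'
  have hKtop : ν K⁻¹ ≠ ∞ := by rw [hKinv]; exact hKc.measure_lt_top.ne
  -- Helgason's averaging lemma
  have hmain := Literature.MeasureTheory.Group.HaarLocalChartLeft.eq_smul_restrict_of_locallyInvariant (μ := ν)
    (ν := (μ.restrict (Λ k : Set V)).map c) hKm (map_restrict_compl_image_eq_zero Λ c μ hopen hcomp hc)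
    (fun g B hBm hB hgB => map_restrict_preimage_mul_eq Λ c μ hanti hopen hcomp hbasis hc hT hI g B hBm hB hgB) hK0 hKtop
  -- read off the constant at `B = K`
  have hK' : ((μ.restrict (Λ k : Set V)).map c) K = μ (Λ k : Set V) := by
    rw [map_restrict_apply_eq Λ c μ hopen hc hKm, inter_eq_left.2 (subset_preimage_image c _)]
  have hκ : (∫⁻ x, (modularCharacter x : ℝ≥0∞) ∂((μ.restrict (Λ k : Set V)).map c)) / ν K⁻¹ = μ (Λ k : Set V) / ν K := by
    have h := congrArg (fun m : Measure G => m K) hmain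
    simp only [Measure.smul_apply, smul_eq_mul, restrict_apply hKm, inter_self] at h
    rw [hK'] at h
    rw [hKinv] at h hK0 hKtop ⊢
    rw [h, ENNReal.mul_div_cancel_right hK0 hKtop]
  rw [← hκ]
  exact hmain

/-- **Measure of chart images**: for `A ⊆ Λ k` with Borel image, `μ (Λ k) · μ A = ν K · ((μ (Λ k) / ν K) · ν (c '' A))`, i.e.
`ν (c '' A) = (ν K / μ (Λ k)) · μ A`. [cite: Helgason2000, Ch. I §1 Thm. 1.14 (13) p. 96] -/
theorem measure_image_eq (hanti : Antitone Λ) (hopen : ∀ j, IsOpen (Λ j : Set V))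
    (hcomp : IsCompact (Λ k : Set V)) (hbasis : ∀ U ∈ 𝓝 (0 : V), ∃ j, (Λ j : Set V) ⊆ U)
    (hc : ContinuousOn c (Λ k : Set V)) (hinj : InjOn c (Λ k : Set V)) (hKo : IsOpen (c '' (Λ k : Set V)))
    (hT : ∀ W ∈ Λ k, ∃ ψ : V → V, ContinuousOn ψ (Λ k : Set V) ∧ ψ 0 ∈ Λ k ∧
      (∀ j, k ≤ j → ∀ x ∈ Λ k, ∀ y ∈ Λ j, ψ (x + y) - ψ x - y ∈ Λ (j + 1)) ∧ ∀ X ∈ Λ k, c (ψ X) = c W * c X)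
    (hI : ∀ W ∈ Λ k, ∃ W' ∈ Λ k, c W' = (c W)⁻¹)
    {A : Set V} (hA : A ⊆ (Λ k : Set V)) (hAm : MeasurableSet (c '' A)) :
    μ A = (μ (Λ k : Set V) / ν (c '' (Λ k : Set V))) * ν (c '' A) := by
  have key := congrArg (fun m : Measure G => m (c '' A))
    (map_restrict_eq_smul_haar Λ c μ ν hanti hopen hcomp hbasis hc hKo hT hI)
  simp only [Measure.smul_apply, smul_eq_mul, restrict_apply hAm, inter_eq_left.2 (image_mono hA)] at key
  rw [map_restrict_apply_eq Λ c μ hopen hc hAm, inter_comm, hinj.preimage_image_inter hA] at key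
  exact key

end Haar

end Summit.HodgeConjecture.HodgeConjecture.Cruxes.H413.F0P3cStCharTSNewtonChartHaar
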